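import Literature.NumberTheory.LFunctions.KadiriMasterInequality
import Literature.NumberTheory.LFunctions.KadiriZeroSum3
import HarnessLib

/-!
# Kadiri's master inequality for one zero, with the third-order far-zero remainder

Topic `Literature/NumberTheory/LFunctions`. Everything in this file is PROVED (no definition, no
named fact). Companion of `KadiriMasterInequality.lean` (Kadiri, Acta Arith. 117 (2005), (1.3) +
Prop. 2.1 + Props. 2.5–2.7 ⇒ (3.10)): the same combination of the fundamental inequality, the
smoothed explicit formula at `s_k = σ + ikγ₀` and `s_k + δ`, and the lower bounds for the
symmetrised zero sums — here the third-order versions `KadiriZeroSum3.lower_bound_kept`,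
`KadiriZeroSum3.lower_bound` — giving `KadiriMaster3.master_ineq`, the statement of
`KadiriMaster.master_ineq` verbatim except that the hypothesis `M(x/η) ≤ M*` (`x ≥ σ − 1`) is replaced
by `M₃(x/η) η ≤ M* t₀` (`M₃ = mtyM3 θ`, `KadiriThirdOrderRemainder.lean`). The proof is the same
bookkeeping.

## References

* H. Kadiri, *Une région explicite sans zéros pour la fonction ζ de Riemann*, Acta Arith. 117
  (2005) = arXiv:math/0401238, (1.3), Prop. 2.1, §2.3–2.5, (3.10), Lemma 3.2. [Kadiri2005]
* M. J. Mossinghoff, T. S. Trudgian, J. Number Theory 157 (2015) = arXiv:1410.3926, §2, (2.2).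
  [MossinghoffTrudgian2015]
-/

noncomputable section

open Complex Real MeasureTheory Set Finset

namespace Literature.NumberTheory.LFunctions

namespace KadiriMaster3

open NicolasJExplicit

variable {θ η : ℝ}

/-- **Kadiri's master inequality for one zero, third-order far-zero remainder** ((3.10) before the
final estimates): the statement of `KadiriMaster.master_ineq` with the hypothesis `M(x/η) ≤ M*`
replaced by `M₃(x/η) η ≤ M* t₀` (`x ≥ σ − 1`),
`a₁ · Pair(ρ₀) ≤ Σ_{k=0}^{n} a_k [f(0)Δ₁(k) + Pole(k) + Δ₂(k) + (1+κ)M*η²·3B(kγ₀, t₀)]`.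
[cite: Kadiri2005, (3.10)] -/
theorem master_ineq (hθ : 0 < θ) (hθ' : θ < π / 2) (hη : 0 < η) {σ δ κ γ₀ t₀ Mst : ℝ}
    {K : ℕ} {b : ℕ → ℝ} (hb : IsNonnegTrigPoly K b) (hK : 1 ≤ K)
    (hσ : 1 / 2 < σ) (hσ1 : σ < 1) (hδ : 0 ≤ δ) (hδ1 : δ < 1) (hδσ : 2 * (1 - σ) ≤ δ)
    (hκ0 : 0 ≤ κ) (hκ1 : κ ≤ 1) (hγ₀ : 0 ≤ γ₀) (ht₀ : 4 ≤ t₀)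
    (hζ : ∀ k ≤ K, riemannZeta ((σ : ℂ) + (((k : ℝ) * γ₀ : ℝ) : ℂ) * I) ≠ 0)
    (hζ' : ∀ k ≤ K, riemannZeta (((σ + δ : ℝ) : ℂ) + (((k : ℝ) * γ₀ : ℝ) : ℂ) * I) ≠ 0)
    (hnear : ∀ k ≤ K, ∀ ρ : Zeros, |(ρ : ℂ).im - (k : ℝ) * γ₀| < t₀ →
      1 - σ ≤ (ρ : ℂ).re ∧ (ρ : ℂ).re ≤ σ)
    (hB : ∀ y : ℝ, κ * ((fordLaplace (kadiriTest θ η) ((δ : ℂ) + y * I)).re +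
        (fordLaplace (kadiriTest θ η) (((2 * σ - 1 + δ : ℝ) : ℂ) + y * I)).re) ≤
      (fordLaplace (kadiriTest θ η) (((0 : ℝ) : ℂ) + y * I)).re +
        (fordLaplace (kadiriTest θ η) (((2 * σ - 1 : ℝ) : ℂ) + y * I)).re)
    (hA : κ * (2 * σ - 1 + 2 * δ) ≤ 2 * σ - 1)
    (hSt : κ * (2 * σ - 1 + 2 * δ) * (-(1 - σ) + (2 * σ - 1) * δ + δ ^ 2 + t₀ ^ 2) ≤
      (2 * σ - 1) * (-(1 - σ) + t₀ ^ 2))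
    (hM : ∀ x : ℝ, σ - 1 ≤ x → mtyM3 θ (x / η) * η ≤ Mst * t₀)
    (ρ₀ : Zeros) (hρ₀ : |(ρ₀ : ℂ).im - γ₀| < t₀) (hβ₀ : 1 / 2 < (ρ₀ : ℂ).re) :
    b 1 * KadiriZeroSum.pairVal θ η σ δ κ γ₀ (ρ₀ : ℂ).re (ρ₀ : ℂ).im ≤
      ∑ k ∈ range (K + 1), b k *
        (kadiriTest θ η 0 * (kadiriT1 ((σ : ℂ) + (((k : ℝ) * γ₀ : ℝ) : ℂ) * I) -
            κ * kadiriT1 (((σ + δ : ℝ) : ℂ) + (((k : ℝ) * γ₀ : ℝ) : ℂ) * I)) +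
          ((fordLaplace (kadiriTest θ η) ((σ : ℂ) + (((k : ℝ) * γ₀ : ℝ) : ℂ) * I - 1)).re -
            κ * (fordLaplace (kadiriTest θ η) (((σ + δ : ℝ) : ℂ) + (((k : ℝ) * γ₀ : ℝ) : ℂ) * I - 1)).re) +
          (kadiriT2 (kadiriTest θ η) ((σ : ℂ) + (((k : ℝ) * γ₀ : ℝ) : ℂ) * I) -
            κ * kadiriT2 (kadiriTest θ η) (((σ + δ : ℝ) : ℂ) + (((k : ℝ) * γ₀ : ℝ) : ℂ) * I)) +
          (1 + κ) * Mst * η ^ 2 * (3 * KadiriTail.tailBound ((k : ℝ) * γ₀) t₀)) := by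
  classical
  have hT := KadiriTest.isSmoothedEFTest hθ hθ' hη
  -- the points `s_k` and `s_k + δ`
  set S : ℕ → ℂ := fun k ↦ (σ : ℂ) + (((k : ℝ) * γ₀ : ℝ) : ℂ) * I with hS
  set S' : ℕ → ℂ := fun k ↦ ((σ + δ : ℝ) : ℂ) + (((k : ℝ) * γ₀ : ℝ) : ℂ) * I with hS'
  have hSre : ∀ k, (S k).re = σ := fun k ↦ by simp [hS]
  have hSδ : ∀ k : ℕ, S k + δ = S' k := fun k ↦ by simp only [hS, hS']; push_cast; ring
  have hS1 : ∀ k, S k ≠ 1 := fun k e ↦ by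
    have := congrArg Complex.re e; rw [hSre] at this; simp at this; linarith
  -- the zero sums at `s_k`
  set Z : ℕ → ℝ := fun k ↦ ∑' ρ : Zeros, (riemannZetaZeroOrder (ρ : ℂ) : ℝ) *
    ((fordLaplace (kadiriTest θ η) (S k - ρ)).re -
      κ * (fordLaplace (kadiriTest θ η) (S' k - ρ)).re) with hZ
  have hZ_split : ∀ k ≤ K, Z k =
      ∑' ρ : Zeros, (riemannZetaZeroOrder (ρ : ℂ) : ℝ) * (fordLaplace (kadiriTest θ η) (S k - ρ)).re -
        κ * ∑' ρ : Zeros, (riemannZetaZeroOrder (ρ : ℂ) : ℝ) *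
          (fordLaplace (kadiriTest θ η) (S' k - ρ)).re := by
    intro k hk
    have h1 := SmoothedEF.summable_zeroOrder_mul_re_fordLaplace hT (s := S k)
      (by rw [hSre]; linarith) (hζ k hk)
    have h2 := SmoothedEF.summable_zeroOrder_mul_re_fordLaplace hT (s := S' k)
      (by simp [hS']; linarith) (hζ' k hk)
    rw [hZ]
    simp only
    rw [← tsum_mul_left, ← (h1.tsum_sub (h2.mul_left κ))]
    refine tsum_congr fun ρ ↦ ?_
    ring
  -- Prop. 2.1 at `s_k` and at `s_k + δ`, combined
  have hexp : ∀ k ≤ K, (fordK (kadiriTest θ η) (S k)).re - κ * (fordK (kadiriTest θ η) (S' k)).re =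
      (kadiriTest θ η 0 * (kadiriT1 (S k) - κ * kadiriT1 (S' k)) +
        ((fordLaplace (kadiriTest θ η) (S k - 1)).re -
          κ * (fordLaplace (kadiriTest θ η) (S' k - 1)).re) +
        (kadiriT2 (kadiriTest θ η) (S k) - κ * kadiriT2 (kadiriTest θ η) (S' k))) - Z k := by
    intro k hk
    have E₂ := KadiriMaster.re_fordK_shift_eq hT hδ hδ1 (s := S k) (by rw [hSre]; linarith) (by rw [hSre]; linarith)
      (hS1 k) (hζ k hk)
    rw [hSδ k] at E₂
    rw [KadiriMaster.re_fordK_eq hT (s := S k) (by rw [hSre]; linarith) (by rw [hSre]; linarith) (hS1 k) (hζ k hk),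
      E₂, hZ_split k hk]
    ring
  -- the fundamental inequality
  have hFI := KadiriFundamental.twisted_trigPoly_nonneg (KadiriTest.nonneg hθ hθ' hη)
    (fun u hu ↦ KadiriTest.eq_zero hθ hθ' hη hu) hb hκ1 hδ σ γ₀
  have hFI' : 0 ≤ ∑ k ∈ range (K + 1), b k *
      ((kadiriTest θ η 0 * (kadiriT1 (S k) - κ * kadiriT1 (S' k)) +
        ((fordLaplace (kadiriTest θ η) (S k - 1)).re -
          κ * (fordLaplace (kadiriTest θ η) (S' k - 1)).re) +
        (kadiriT2 (kadiriTest θ η) (S k) - κ * kadiriT2 (kadiriTest θ η) (S' k))) - Z k) := by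
    refine hFI.trans_eq (Finset.sum_congr rfl fun k hk ↦ ?_)
    have hk' : k ≤ K := Nat.lt_succ_iff.1 (Finset.mem_range.1 hk)
    rw [← hexp k hk']
  -- lower bounds for the zero sums
  set tail : ℕ → ℝ := fun k ↦ (1 + κ) * Mst * η ^ 2 * (3 * KadiriTail.tailBound ((k : ℝ) * γ₀) t₀)
    with htail
  have hZ1 : KadiriZeroSum.pairVal θ η σ δ κ γ₀ (ρ₀ : ℂ).re (ρ₀ : ℂ).im - tail 1 ≤ Z 1 := by
    have h := KadiriZeroSum3.lower_bound_kept hθ hθ' hη (t := ((1 : ℕ) : ℝ) * γ₀) (t₀ := t₀)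
      hσ hσ1.le (by positivity) hδ hδσ hκ0 ht₀ (hζ 1 hK) (hζ' 1 hK) (hnear 1 hK) hB hA hSt hM ρ₀
      (by simpa using hρ₀) hβ₀
    have e : ((1 : ℕ) : ℝ) * γ₀ = γ₀ := by simp
    simp only [htail, hZ, hS, hS']
    rw [e] at h ⊢
    exact h
  have hZk : ∀ k ≤ K, -tail k ≤ Z k := by
    intro k hk
    have h := KadiriZeroSum3.lower_bound hθ hθ' hη (t := (k : ℝ) * γ₀) (t₀ := t₀)
      hσ hσ1.le (by positivity) hδ hδσ hκ0 ht₀ (hζ k hk) (hζ' k hk) (hnear k hk) hB hA hSt hM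
    simpa only [htail, hZ, hS, hS'] using h
  -- `Σ_k b_k Z_k ≥ b₁ Pair − Σ_k b_k tail_k`
  have hb0 : ∀ k, 0 ≤ b k := hb.1
  have h1mem : 1 ∈ range (K + 1) := Finset.mem_range.2 (by omega)
  have hsumZ : b 1 * KadiriZeroSum.pairVal θ η σ δ κ γ₀ (ρ₀ : ℂ).re (ρ₀ : ℂ).im -
      ∑ k ∈ range (K + 1), b k * tail k ≤ ∑ k ∈ range (K + 1), b k * Z k := by
    rw [← Finset.add_sum_erase _ _ h1mem, ← Finset.add_sum_erase _ (fun k ↦ b k * Z k) h1mem]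
    have hrest : ∑ k ∈ (range (K + 1)).erase 1, -(b k * tail k) ≤
        ∑ k ∈ (range (K + 1)).erase 1, b k * Z k := by
      refine Finset.sum_le_sum fun k hk ↦ ?_
      have hk' : k ≤ K := Nat.lt_succ_iff.1 (Finset.mem_range.1 (Finset.mem_of_mem_erase hk))
      have := mul_le_mul_of_nonneg_left (hZk k hk') (hb0 k)
      linarith
    have h1 := mul_le_mul_of_nonneg_left hZ1 (hb0 1)
    rw [Finset.sum_neg_distrib] at hrest
    linarith
  -- combine with the fundamental inequality
  have hsplit : ∑ k ∈ range (K + 1), b k *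
      ((kadiriTest θ η 0 * (kadiriT1 (S k) - κ * kadiriT1 (S' k)) +
        ((fordLaplace (kadiriTest θ η) (S k - 1)).re -
          κ * (fordLaplace (kadiriTest θ η) (S' k - 1)).re) +
        (kadiriT2 (kadiriTest θ η) (S k) - κ * kadiriT2 (kadiriTest θ η) (S' k))) - Z k) =
      ∑ k ∈ range (K + 1), b k *
        ((kadiriTest θ η 0 * (kadiriT1 (S k) - κ * kadiriT1 (S' k)) +
          ((fordLaplace (kadiriTest θ η) (S k - 1)).re -
            κ * (fordLaplace (kadiriTest θ η) (S' k - 1)).re) +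
          (kadiriT2 (kadiriTest θ η) (S k) - κ * kadiriT2 (kadiriTest θ η) (S' k))) + tail k) -
        ∑ k ∈ range (K + 1), b k * tail k - ∑ k ∈ range (K + 1), b k * Z k := by
    rw [← Finset.sum_sub_distrib, ← Finset.sum_sub_distrib]
    refine Finset.sum_congr rfl fun k _ ↦ ?_
    ring
  rw [hsplit] at hFI'
  have : b 1 * KadiriZeroSum.pairVal θ η σ δ κ γ₀ (ρ₀ : ℂ).re (ρ₀ : ℂ).im ≤
      ∑ k ∈ range (K + 1), b k *
        ((kadiriTest θ η 0 * (kadiriT1 (S k) - κ * kadiriT1 (S' k)) +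
          ((fordLaplace (kadiriTest θ η) (S k - 1)).re -
            κ * (fordLaplace (kadiriTest θ η) (S' k - 1)).re) +
          (kadiriT2 (kadiriTest θ η) (S k) - κ * kadiriT2 (kadiriTest θ η) (S' k))) + tail k) := by
    linarith
  simpa only [hS, hS', htail] using this

end KadiriMaster3

end Literature.NumberTheory.LFunctions
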